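import Summits.CriticalPhenomena.Ising3D.ExclusionSentencesTrgGamma

/-!
# Exclusion sentences — 2D control, third datum `c = 1/2` vs the FULL `TRG` table at `10⁻⁷`, part 1 of 2
(cell `pub-ising3x`, seat recog-1, gen 6)

HONEST FRAMING: lottery ticket; floor = tightest certified 3D Ising CFT bounds; no exact-solution
claim without a proof.

The whole FAMILIES-v1 family `TRG` (`D ≤ 17`, `h ≤ 32`, `Γ(¼)`/`Γ(⅓)` powers included) near the 2D control's third
datum `c = 1/2`: fifteen members within the blind width `10⁻⁵`, two within `10⁻⁶`
(`(29/17)·√2·Γ(¼)/π^{5/2}`, `(32/19)·√π·ζ(3)/Γ(⅓)²`; Python twin `tools/trg_gamma_exceptions.py`, exclusion data, not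
listed here), NONE within `10⁻⁷` — the exception list is EMPTY.  This file: parts `0–3`;
`ExclusionSentencesControl2DTrgGammaC7Fin.lean`: parts `4–7`, the assembled sentence and the printed shape.  Used by
`ExclusionSentencesControl2DRecognisedC.lean`.  No 3D digit is used anywhere.
-/

namespace Summit.CriticalPhenomena.Ising3D

/-- Part 0 (classes `Γ(¼)^{−4}`, `Γ(¼)^{−3}`) of the full-TRG sentence on `[1/2 − 10⁻⁷, 1/2 + 10⁻⁷]`, empty list. -/
theorem trgFull_control_c7_p0 :
    trgFullPart 17 32 0 (1 / 2 - 1 / 10 ^ 7) (1 / 2 + 1 / 10 ^ 7) [] = true := by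
  decide +kernel

/-- Part 1 (classes `Γ(¼)^{−2}`, `Γ(¼)^{−1}`) of the full-TRG sentence on `[1/2 − 10⁻⁷, 1/2 + 10⁻⁷]`, empty list. -/
theorem trgFull_control_c7_p1 :
    trgFullPart 17 32 1 (1 / 2 - 1 / 10 ^ 7) (1 / 2 + 1 / 10 ^ 7) [] = true := by
  decide +kernel

/-- Part 2 (classes `Γ`-free, `Γ(¼)¹`) of the full-TRG sentence on `[1/2 − 10⁻⁷, 1/2 + 10⁻⁷]`, empty list. -/
theorem trgFull_control_c7_p2 :
    trgFullPart 17 32 2 (1 / 2 - 1 / 10 ^ 7) (1 / 2 + 1 / 10 ^ 7) [] = true := by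
  decide +kernel

/-- Part 3 (classes `Γ(¼)²`, `Γ(¼)³`) of the full-TRG sentence on `[1/2 − 10⁻⁷, 1/2 + 10⁻⁷]`, empty list. -/
theorem trgFull_control_c7_p3 :
    trgFullPart 17 32 3 (1 / 2 - 1 / 10 ^ 7) (1 / 2 + 1 / 10 ^ 7) [] = true := by
  decide +kernel

end Summit.CriticalPhenomena.Ising3D
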